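/-
Copyright (c) 2026 the pub-hodgecm-mathlib formalisation cell (harness21).  Prover seat hodgecm-mathlib-K2E3-p17 (g10), HCML Track B «K2-LIT» ∕ h413
(`stmt-HodgeConjecture-24833`), R90-TF section S3 hand (W5-e) «PAYER of E's print socket `stub_R90_S3_print_492_lds`» (DEAL-S3-WAVE5 §1 (W5-e), R90-C12-plan (g2)
2026-09-04T23:09:04Z; census `R90/S3/CENSUS-W5e-lds.K2E3-p17-g10.md`).  2026-09-04.
-/
import Summits.HodgeConjecture.HodgeConjecture.Theorems.F0P3bInducedCharTransferSigned      -- ★ A1 vocabulary (`IsLocSmooth`, `IsLocalDeltaTransfer`, `finExplicitCollection`, `cmPrincipalSeriesH`, `IsFiniteLength`)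
import Summits.HodgeConjecture.HodgeConjecture.Theorems.F0P3bPrincipalSeriesTrace             -- ★ (e1) `smoothTrace_comp_eq_add_of_constituents_eq_pair`
import Summits.HodgeConjecture.HodgeConjecture.Theorems.R90S3PrincipalSeriesFiniteLength        -- ★ `not_bot_lt_lt_lt_top_cmPrincipalSeriesH` (no 3-chains in `i_H`)
import Summits.HodgeConjecture.HodgeConjecture.Theorems.R90S3IsFiniteLengthOfChainBound         -- ★ `isFiniteLength_asModule_of_forall_not_bot_lt_lt_lt_top`
import Summits.HodgeConjecture.HodgeConjecture.Theorems.K2E3SmoothTraceCompositionSeries       -- ★ `le_iff_toSubmodule_le` (subrepresentation order = carrier inclusion)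
import Literature.NumberTheory.Automorphic.UnitaryGroupPrincipalSeriesHLattice                   -- ★ (e2) `isConstituentOf_cmPrincipalSeriesH_iff`
import Literature.NumberTheory.Automorphic.CMPrincipalSeriesHAdmissible                          -- ★ `isAdmissible_cmPrincipalSeriesH`
import Literature.NumberTheory.Automorphic.IrreducibleClassesComapInner                          -- ★ `IrrClass.comap_refl`
import Literature.NumberTheory.Automorphic.IrreducibleClassesBoxChar                             -- ★ `IrrClass.boxChar`, `boxChar_injective`
import Literature.NumberTheory.Rogawski1990.FinExplicitTransferFactorConjRight                    -- ★ `finExplicitDelta_conj_left_all ∕ _right_all`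
import Literature.NumberTheory.Automorphic.OrbitalMeasureCanonical                               -- ★ `OrbitalMeasureFamily`
import HarnessLib

/-!
# R90 · S3 · (W5-e) — PAYER of E's print socket `stub_R90_S3_print_492_lds` (Lemma 4.9.2, virtual-character shape, l.d.s.-type `H_v` packets),
# hypothesis-first over (W5-d) = the `_492_indPS` identity and (TWO) = the two inequivalent constituents of `i(χ₁, χ₂)` at `χ₁|F^× = ω`

R90-TF section S3 (dealer R90-C12-plan (g2), DEAL-S3-WAVE5 §1 (W5-e), words 23:09:04Z; census-first: `R90/S3/CENSUS-W5e-lds.K2E3-p17-g10.md` 87da30e8535e077c);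
seat K2E3-p17 (g10); crux H413 = `stmt-HodgeConjecture-24833` (lane `--kind proof --supports … --as helper`).  THEOREMS ONLY (no `def`, no instance, no notation,
no named fact, no `sorry`); ★ imports only (Theorems never import `Cruxes/…/Lines`).

THE SOCKET (E ED. 2 :275–:334): over A1's frame + `(ρ) (hρ)`: for `ρ = O ⊠ χ` with `O` = THE SET of constituents of `i := i_{U(Φ₂)}(χ₁, χ₂) = cmPrincipalSeries L 2 v θ`,
`θ := torusCharPair … 0 χ₁ χ₂`, `χ₁|F^× = ω` (`IsQuadraticCharExtension`): `∃ (ε : ℤ) (I admissible of finite length on G′_v), ∀ Δ‴_v-matched smooth (fH, f),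
Σ_{σ∈ρ} Tr σ(fH) = ε · Tr I(f)` [Rogawski1990, §4.9 L. 4.9.2 pp. 55–56; §11.1 Prop. 11.1.1 (c); §12.1 (6) p. 171; §12.2 pp. 172–173].
THE PAYMENT `print_492_lds` (the socket's binders `hH′ hH′d hμu hμω hm hT hρ` are unused and dropped — as ★ (R-ii); `hρ`'s only use, `ρ ≠ ∅`, is replaced by the
trivial `O = ∅` branch) from two hypotheses, both TYPED ELSEWHERE IN THE TREE:
* `h492` = E's `stub_R90_S3_print_492_indPS … ρ hρ` CONCLUSION (E :244–:256, token for token; the same `ρ`): Lemma 4.9.2 SIGNED for `i_H(χ₂ ⊠ χ₁)` whenever some member of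
  `ρ` is a constituent — payer (W5-d) `print_492_indPS` (R90-C14-p01 ⟸ K2E3-p21's (W5-a) `R90S3InducedCharTransferSignedGeneral`);
* `hTwo` = S4-B's socket (TWO) `stub_R90_S4_U2_ldsTwo L v hv` (`Lines/R90_S4_HPacketsU2B.lean` :460; ED. 4 PAID modulo S4's LDS-DECOMP by ★ `R90.S4.two_of_isCompl`) with its
  open-kernel premises traded for «`i(χ₁, χ₂)` has a constituent» (adapter brick (W5-e″) `ldsTwo_of_constituent`: a constituent makes `θ` continuous, and
  `(θ ∘ ι₂, 1)` is a continuous pair with the same `θ` and the same restriction to `F^×` — ★ `torusCharPair_comp_torusChartHom₂_eq`): «at `χ₁|F^× = ω` the principal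
  series `i(χ₁, χ₂)` has EXACTLY TWO constituents `π₁ ≠ π₂`» [Rogawski1990, §11.1 Prop. 11.1.1 (c)] — this is MULTIPLICITY ONE, without which `Σ_{σ∈ρ} Tr σ = ½ Tr i_H`
  would break the integral shape of the socket.
THE PROOF: `O = ∅` ⇒ `ρ = ∅`, take `ε := 0`, `I :=` the zero representation (admissible, finite length).  Else (TWO) ⇒ `O = {π₁, π₂}`, `ρ = {π₁ ⊠ χ, π₂ ⊠ χ}`
(`boxChar_injective`), `Σ_{σ∈ρ} Tr σ = Tr(π₁ ⊠ χ) + Tr(π₂ ⊠ χ)`; the constituents of `i_H := cmPrincipalSeriesH L v θ χ = (i ∘ fst) ⊗ (χ ∘ snd)` are exactly the two boxes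
(★ (e2) `isConstituentOf_cmPrincipalSeriesH_iff`) and `i_H` has no 3-chains (★ `not_bot_lt_lt_lt_top_cmPrincipalSeriesH`) and is admissible (★ `isAdmissible_cmPrincipalSeriesH`),
so `Tr i_H = Tr(π₁ ⊠ χ) + Tr(π₂ ⊠ χ)` (★ (e1) `smoothTrace_comp_eq_add_of_constituents_eq_pair` at `e := refl`, ★ `IrrClass.comap_refl`); finally `h492 θ χ hχ ⟨π₁ ⊠ χ, …⟩`.
PLUG (E ED. n, S3 pen): `stub_R90_S3_print_492_lds … ρ hρ := print_492_lds L H′ v μ hv νG νH mH mG ρ (‹_492_indPS› … ρ hρ) (ldsTwo_of_constituent L v (stub_R90_S4_U2_ldsTwo L v hv))` (`hH′ hH′d` are not binders: nothing here depends on them)`.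

HONEST LABEL: an assembly — it pays `_492_lds` only modulo (W5-d) (print L. 4.9.2 signed at general χ) and S4's (TWO)∕LDS-DECOMP; nothing printed in Ch. 13 is proved here;
HC_CM is proved only modulo the 7 printed citations (2 remaining named inputs: hLiu418 = stmt-HodgeConjecture-24832, h413 = stmt-HodgeConjecture-24833) until rung 0
closes; count-neutral.
-/

set_option autoImplicit false
-- the mandated namespace repeats the single-problem summit's segment (`HodgeConjecture.HodgeConjecture`)
set_option linter.dupNamespace false

noncomputable section

namespace Summit.HodgeConjecture.HodgeConjecture.R90.S3

open MeasureTheory IsDedekindDomain NumberField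
open Literature.NumberTheory Literature.NumberTheory.Automorphic Literature.NumberTheory.Automorphic.UnitaryGroup
open Literature.NumberTheory.Rogawski1990 Literature.NumberTheory.GaloisRepresentations
open Summit.HodgeConjecture.HodgeConjecture.Cruxes.H413.F0P3bPrincipalSeriesTrace (smoothTrace_comp_eq_add_of_constituents_eq_pair)
open scoped Matrix

variable (L : Type) [Field L] [NumberField L] [IsCMField L] (H' : Matrix (Fin 3) (Fin 3) L)
  (v : HeightOneSpectrum (𝓞 ↥(maximalRealSubfield L)))

set_option maxHeartbeats 1600000 in  -- the CM-carrier telescopes of the two hypotheses and the socket conclusion in one statement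
/-- **(W5-e) — E's print socket `stub_R90_S3_print_492_lds` from (W5-d) `_492_indPS` and S4's (TWO)** (conclusion = E :314–:333 token for token; see the module
docstring for the plug term). [cite: Rogawski1990, §4.9 Lemma 4.9.2 pp. 55–56; §11.1 Prop. 11.1.1 (c) pp. 161–162; §12.1 p. 171; §12.2 pp. 172–173; §13.1 Thm. 13.1.1 (2) p. 198] -/
theorem print_492_lds
    (μ : HeckeCharacter L)
    (hv : ∀ w : UnitaryGroup.PlacesOver L v, IsCMField.complexConj L • w.1 = w.1)
    [MeasurableSpace ((UnitaryGroup.cmDatum L 3 H').Local v)] [BorelSpace ((UnitaryGroup.cmDatum L 3 H').Local v)]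
    [MeasurableSpace ((UnitaryGroup.cmDatum L 2 (Matrix.of fun i j : Fin 2 => if i.val + j.val + 1 = 2 then (1 : L) else 0)).Local v ×
      (UnitaryGroup.cmDatum L 1 (Matrix.of fun i j : Fin 1 => if i.val + j.val + 1 = 1 then (1 : L) else 0)).Local v)]
    [BorelSpace ((UnitaryGroup.cmDatum L 2 (Matrix.of fun i j : Fin 2 => if i.val + j.val + 1 = 2 then (1 : L) else 0)).Local v ×
      (UnitaryGroup.cmDatum L 1 (Matrix.of fun i j : Fin 1 => if i.val + j.val + 1 = 1 then (1 : L) else 0)).Local v)]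
    [∀ a : ((UnitaryGroup.cmDatum L 2 (Matrix.of fun i j : Fin 2 => if i.val + j.val + 1 = 2 then (1 : L) else 0)).Local v ×
      (UnitaryGroup.cmDatum L 1 (Matrix.of fun i j : Fin 1 => if i.val + j.val + 1 = 1 then (1 : L) else 0)).Local v),
      MeasurableSpace (((UnitaryGroup.cmDatum L 2 (Matrix.of fun i j : Fin 2 => if i.val + j.val + 1 = 2 then (1 : L) else 0)).Local v ×
      (UnitaryGroup.cmDatum L 1 (Matrix.of fun i j : Fin 1 => if i.val + j.val + 1 = 1 then (1 : L) else 0)).Local v) ⧸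
        Subgroup.centralizer ({a} : Set ((UnitaryGroup.cmDatum L 2 (Matrix.of fun i j : Fin 2 => if i.val + j.val + 1 = 2 then (1 : L) else 0)).Local v ×
      (UnitaryGroup.cmDatum L 1 (Matrix.of fun i j : Fin 1 => if i.val + j.val + 1 = 1 then (1 : L) else 0)).Local v)))]
    [∀ a : ((UnitaryGroup.cmDatum L 2 (Matrix.of fun i j : Fin 2 => if i.val + j.val + 1 = 2 then (1 : L) else 0)).Local v ×
      (UnitaryGroup.cmDatum L 1 (Matrix.of fun i j : Fin 1 => if i.val + j.val + 1 = 1 then (1 : L) else 0)).Local v),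
      BorelSpace (((UnitaryGroup.cmDatum L 2 (Matrix.of fun i j : Fin 2 => if i.val + j.val + 1 = 2 then (1 : L) else 0)).Local v ×
      (UnitaryGroup.cmDatum L 1 (Matrix.of fun i j : Fin 1 => if i.val + j.val + 1 = 1 then (1 : L) else 0)).Local v) ⧸
        Subgroup.centralizer ({a} : Set ((UnitaryGroup.cmDatum L 2 (Matrix.of fun i j : Fin 2 => if i.val + j.val + 1 = 2 then (1 : L) else 0)).Local v ×
      (UnitaryGroup.cmDatum L 1 (Matrix.of fun i j : Fin 1 => if i.val + j.val + 1 = 1 then (1 : L) else 0)).Local v)))]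
    [∀ γ : ((UnitaryGroup.cmDatum L 3 H').Local v), MeasurableSpace (((UnitaryGroup.cmDatum L 3 H').Local v) ⧸ Subgroup.centralizer ({γ} : Set ((UnitaryGroup.cmDatum L 3 H').Local v)))]
    [∀ γ : ((UnitaryGroup.cmDatum L 3 H').Local v), BorelSpace (((UnitaryGroup.cmDatum L 3 H').Local v) ⧸ Subgroup.centralizer ({γ} : Set ((UnitaryGroup.cmDatum L 3 H').Local v)))]
    (νG : Measure ((UnitaryGroup.cmDatum L 3 H').Local v)) [νG.IsHaarMeasure] [νG.IsMulRightInvariant]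
    (νH : Measure ((UnitaryGroup.cmDatum L 2 (Matrix.of fun i j : Fin 2 => if i.val + j.val + 1 = 2 then (1 : L) else 0)).Local v ×
      (UnitaryGroup.cmDatum L 1 (Matrix.of fun i j : Fin 1 => if i.val + j.val + 1 = 1 then (1 : L) else 0)).Local v))
    [νH.IsHaarMeasure] [νH.IsMulRightInvariant]
    (mH : OrbitalMeasureFamily ((UnitaryGroup.cmDatum L 2 (Matrix.of fun i j : Fin 2 => if i.val + j.val + 1 = 2 then (1 : L) else 0)).Local v ×
      (UnitaryGroup.cmDatum L 1 (Matrix.of fun i j : Fin 1 => if i.val + j.val + 1 = 1 then (1 : L) else 0)).Local v))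
    (mG : OrbitalMeasureFamily ((UnitaryGroup.cmDatum L 3 H').Local v))
    (ρ : Finset (IrrClass ((UnitaryGroup.cmDatum L 2 (Matrix.of fun i j : Fin 2 => if i.val + j.val + 1 = 2 then (1 : L) else 0)).Local v ×
      (UnitaryGroup.cmDatum L 1 (Matrix.of fun i j : Fin 1 => if i.val + j.val + 1 = 1 then (1 : L) else 0)).Local v)))
    (h492 :
    ∀ (χ₂ : ↥(torusU (conjLocal L (IsCMField.complexConj L) v) (cmLocalForm L 2 v)) →* ℂˣ)
        (χ₁ : (UnitaryGroup.cmDatum L 1 (Matrix.of fun i j : Fin 1 => if i.val + j.val + 1 = 1 then (1 : L) else 0)).Local v →* ℂˣ),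
        IsOpen ((χ₁.ker : Subgroup ((UnitaryGroup.cmDatum L 1 (Matrix.of fun i j : Fin 1 => if i.val + j.val + 1 = 1 then (1 : L) else 0)).Local v)) : Set ((UnitaryGroup.cmDatum L 1 (Matrix.of fun i j : Fin 1 => if i.val + j.val + 1 = 1 then (1 : L) else 0)).Local v)) →
        (∃ σ ∈ ρ, σ.IsConstituentOf (cmPrincipalSeriesH L v χ₂ χ₁)) →
        ∃ (ε : ℤ) (W : Type) (_ : AddCommGroup W) (_ : Module ℂ W) (I : Representation ℂ ((UnitaryGroup.cmDatum L 3 H').Local v) W),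
          I.IsAdmissible ∧ IsFiniteLength (MonoidAlgebra ℂ ((UnitaryGroup.cmDatum L 3 H').Local v)) I.asModule ∧
          ∀ (fH : (UnitaryGroup.cmDatum L 2 (Matrix.of fun i j : Fin 2 => if i.val + j.val + 1 = 2 then (1 : L) else 0)).Local v ×
              (UnitaryGroup.cmDatum L 1 (Matrix.of fun i j : Fin 1 => if i.val + j.val + 1 = 1 then (1 : L) else 0)).Local v → ℂ)
            (f : (UnitaryGroup.cmDatum L 3 H').Local v → ℂ),
            IsLocSmooth fH → IsLocSmooth f →
              IsLocalDeltaTransfer L H' v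
                (finExplicitCollection L H' μ (finExplicitDelta_conj_left_all L H' μ) (finExplicitDelta_conj_right_all L H' μ) v) mH mG fH f →
              (cmPrincipalSeriesH L v χ₂ χ₁).smoothTrace νH fH = (ε : ℂ) * I.smoothTrace νG f )
    (hTwo : ∀ (χ₁ : (UnitaryGroup.LocalRing L v)ˣ →* ℂˣ) (χ₂ : ↥(normOneUnits (conjLocal L (IsCMField.complexConj L) v)) →* ℂˣ),
      IsQuadraticCharExtension (conjLocal L (IsCMField.complexConj L) v) χ₁ →
      (∃ c : IrrClass ((UnitaryGroup.cmDatum L 2 (Matrix.of fun i j : Fin 2 => if i.val + j.val + 1 = 2 then (1 : L) else 0)).Local v),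
        c.IsConstituentOf
          (cmPrincipalSeries L 2 v
            (torusCharPair (conjLocal L (IsCMField.complexConj L) v) (cmLocalForm L 2 v) (cmLocalForm_eq_over L 2 v) 0 χ₁ χ₂))) →
      ∃ π₁ π₂ : IrrClass ((UnitaryGroup.cmDatum L 2 (Matrix.of fun i j : Fin 2 => if i.val + j.val + 1 = 2 then (1 : L) else 0)).Local v), π₁ ≠ π₂ ∧
        ∀ c : IrrClass ((UnitaryGroup.cmDatum L 2 (Matrix.of fun i j : Fin 2 => if i.val + j.val + 1 = 2 then (1 : L) else 0)).Local v), c.IsConstituentOf (cmPrincipalSeries L 2 v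
          (torusCharPair (conjLocal L (IsCMField.complexConj L) v) (cmLocalForm L 2 v) (cmLocalForm_eq_over L 2 v) 0 χ₁ χ₂)) ↔
            c = π₁ ∨ c = π₂)
    :
    ∀ (O : Finset (IrrClass ((UnitaryGroup.cmDatum L 2 (Matrix.of fun i j : Fin 2 => if i.val + j.val + 1 = 2 then (1 : L) else 0)).Local v)))
        (χ : (UnitaryGroup.cmDatum L 1 (Matrix.of fun i j : Fin 1 => if i.val + j.val + 1 = 1 then (1 : L) else 0)).Local v →* ℂˣ)
        (hχ : IsOpen ((χ.ker : Subgroup ((UnitaryGroup.cmDatum L 1 (Matrix.of fun i j : Fin 1 => if i.val + j.val + 1 = 1 then (1 : L) else 0)).Local v)) :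
          Set ((UnitaryGroup.cmDatum L 1 (Matrix.of fun i j : Fin 1 => if i.val + j.val + 1 = 1 then (1 : L) else 0)).Local v)))
        (χ₁ : (UnitaryGroup.LocalRing L v)ˣ →* ℂˣ) (χ₂ : ↥(normOneUnits (conjLocal L (IsCMField.complexConj L) v)) →* ℂˣ),
        IsQuadraticCharExtension (conjLocal L (IsCMField.complexConj L) v) χ₁ →
        (∀ c : IrrClass ((UnitaryGroup.cmDatum L 2 (Matrix.of fun i j : Fin 2 => if i.val + j.val + 1 = 2 then (1 : L) else 0)).Local v), c ∈ O ↔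
          c.IsConstituentOf
            (cmPrincipalSeries L 2 v
              (torusCharPair (conjLocal L (IsCMField.complexConj L) v) (cmLocalForm L 2 v) (cmLocalForm_eq_over L 2 v) 0 χ₁ χ₂))) →
        ρ = O.map ⟨IrrClass.boxChar χ hχ, IrrClass.boxChar_injective χ hχ⟩ →
          ∃ (ε : ℤ) (W : Type) (_ : AddCommGroup W) (_ : Module ℂ W) (I : Representation ℂ ((UnitaryGroup.cmDatum L 3 H').Local v) W),
            I.IsAdmissible ∧ IsFiniteLength (MonoidAlgebra ℂ ((UnitaryGroup.cmDatum L 3 H').Local v)) I.asModule ∧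
            ∀ (fH : (UnitaryGroup.cmDatum L 2 (Matrix.of fun i j : Fin 2 => if i.val + j.val + 1 = 2 then (1 : L) else 0)).Local v ×
                (UnitaryGroup.cmDatum L 1 (Matrix.of fun i j : Fin 1 => if i.val + j.val + 1 = 1 then (1 : L) else 0)).Local v → ℂ)
              (f : (UnitaryGroup.cmDatum L 3 H').Local v → ℂ),
              IsLocSmooth fH → IsLocSmooth f →
                IsLocalDeltaTransfer L H' v
                  (finExplicitCollection L H' μ (finExplicitDelta_conj_left_all L H' μ) (finExplicitDelta_conj_right_all L H' μ) v) mH mG fH f →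
                ∑ σ ∈ ρ, σ.smoothTrace νH fH = (ε : ℂ) * I.smoothTrace νG f  := by
  intro O χ hχ χ₁ χ₂ hq hO hρO
  classical
  haveI := locallyCompactSpace_cmBorelU L 2 v
  by_cases hOe : O = ∅
  · -- the empty packet: `ρ = ∅`, `ε := 0`, `I :=` the zero representation
    refine ⟨0, PUnit, inferInstance, inferInstance, Representation.trivial ℂ ((UnitaryGroup.cmDatum L 3 H').Local v) PUnit, ?_, ?_, fun fH f _ _ _ => ?_⟩
    · refine ⟨fun x => ?_, fun K _ => Module.Finite.of_finite⟩
      have hst : ((Representation.trivial ℂ ((UnitaryGroup.cmDatum L 3 H').Local v) PUnit).stabilizerSubgroup x : Set ((UnitaryGroup.cmDatum L 3 H').Local v)) = Set.univ := by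
        ext g
        simp
      change IsOpen ((Representation.trivial ℂ ((UnitaryGroup.cmDatum L 3 H').Local v) PUnit).stabilizerSubgroup x : Set ((UnitaryGroup.cmDatum L 3 H').Local v))
      rw [hst]
      exact isOpen_univ
    · refine isFiniteLength_asModule_of_forall_not_bot_lt_lt_lt_top (Representation.trivial ℂ ((UnitaryGroup.cmDatum L 3 H').Local v) PUnit) fun N₁ N₂ h => ?_
      have hle : N₂ ≤ N₁ := (Summit.HodgeConjecture.HodgeConjecture.Cruxes.H413.K2E3SmoothTraceCompositionSeries.le_iff_toSubmodule_le N₂ N₁).2 fun x _ => by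
        rw [Subsingleton.elim x 0]
        exact N₁.toSubmodule.zero_mem
      exact (not_lt_of_ge hle) h.2.1
    · rw [hρO, hOe, Finset.map_empty, Finset.sum_empty, Int.cast_zero, zero_mul]
  -- a constituent exists; (TWO): `O = {π₁, π₂}`
  obtain ⟨c₀, hc₀⟩ := Finset.nonempty_iff_ne_empty.2 hOe
  obtain ⟨π₁, π₂, hne, hJH⟩ := hTwo χ₁ χ₂ hq ⟨c₀, (hO c₀).1 hc₀⟩
  have hOeq : O = {π₁, π₂} := by
    ext c
    rw [hO c, hJH c, Finset.mem_insert, Finset.mem_singleton]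
  have hne' : IrrClass.boxChar χ hχ π₁ ≠ IrrClass.boxChar χ hχ π₂ := fun h => hne (IrrClass.boxChar_injective χ hχ h)
  -- `Σ_{σ∈ρ} = Tr(π₁ ⊠ χ) + Tr(π₂ ⊠ χ)`
  have hsum : ∀ fH : ((UnitaryGroup.cmDatum L 2 (Matrix.of fun i j : Fin 2 => if i.val + j.val + 1 = 2 then (1 : L) else 0)).Local v ×
      (UnitaryGroup.cmDatum L 1 (Matrix.of fun i j : Fin 1 => if i.val + j.val + 1 = 1 then (1 : L) else 0)).Local v) → ℂ,
      ∑ σ ∈ ρ, σ.smoothTrace νH fH = (IrrClass.boxChar χ hχ π₁).smoothTrace νH fH + (IrrClass.boxChar χ hχ π₂).smoothTrace νH fH := by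
    intro fH
    rw [hρO, Finset.sum_map, hOeq, Finset.sum_pair hne]
    rfl
  -- the constituents of `i_H(θ ⊠ χ)` are exactly the two boxes
  have hJHH : ∀ c' : IrrClass ((UnitaryGroup.cmDatum L 2 (Matrix.of fun i j : Fin 2 => if i.val + j.val + 1 = 2 then (1 : L) else 0)).Local v ×
      (UnitaryGroup.cmDatum L 1 (Matrix.of fun i j : Fin 1 => if i.val + j.val + 1 = 1 then (1 : L) else 0)).Local v),
      c'.IsConstituentOf (cmPrincipalSeriesH L v (torusCharPair (conjLocal L (IsCMField.complexConj L) v) (cmLocalForm L 2 v) (cmLocalForm_eq_over L 2 v) 0 χ₁ χ₂) χ) ↔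
        (c' = IrrClass.boxChar χ hχ π₂ ∨ c' = IrrClass.boxChar χ hχ π₁) := by
    intro c'
    rw [isConstituentOf_cmPrincipalSeriesH_iff L v (torusCharPair (conjLocal L (IsCMField.complexConj L) v) (cmLocalForm L 2 v) (cmLocalForm_eq_over L 2 v) 0 χ₁ χ₂) χ hχ c']
    constructor
    · rintro ⟨c, rfl, hc⟩
      rcases (hJH c).1 hc with rfl | rfl
      · exact Or.inr rfl
      · exact Or.inl rfl
    · rintro (rfl | rfl)
      · exact ⟨π₂, rfl, (hJH π₂).2 (Or.inr rfl)⟩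
      · exact ⟨π₁, rfl, (hJH π₁).2 (Or.inl rfl)⟩
  -- `Tr i_H = Tr(π₁ ⊠ χ) + Tr(π₂ ⊠ χ)` (★ (e1) at `e := refl`; no 3-chains, admissible)
  have hadmH : (cmPrincipalSeriesH L v (torusCharPair (conjLocal L (IsCMField.complexConj L) v) (cmLocalForm L 2 v) (cmLocalForm_eq_over L 2 v) 0 χ₁ χ₂) χ).IsAdmissible := isAdmissible_cmPrincipalSeriesH L v (torusCharPair (conjLocal L (IsCMField.complexConj L) v) (cmLocalForm L 2 v) (cmLocalForm_eq_over L 2 v) 0 χ₁ χ₂) χ hχ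
  have hlenH := not_bot_lt_lt_lt_top_cmPrincipalSeriesH L v hv (torusCharPair (conjLocal L (IsCMField.complexConj L) v) (cmLocalForm L 2 v) (cmLocalForm_eq_over L 2 v) 0 χ₁ χ₂) χ
  have hTA : ∀ fH : ((UnitaryGroup.cmDatum L 2 (Matrix.of fun i j : Fin 2 => if i.val + j.val + 1 = 2 then (1 : L) else 0)).Local v ×
      (UnitaryGroup.cmDatum L 1 (Matrix.of fun i j : Fin 1 => if i.val + j.val + 1 = 1 then (1 : L) else 0)).Local v) → ℂ,
      (cmPrincipalSeriesH L v (torusCharPair (conjLocal L (IsCMField.complexConj L) v) (cmLocalForm L 2 v) (cmLocalForm_eq_over L 2 v) 0 χ₁ χ₂) χ).smoothTrace νH fH =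
        (IrrClass.boxChar χ hχ π₁).smoothTrace νH fH + (IrrClass.boxChar χ hχ π₂).smoothTrace νH fH := by
    intro fH
    have h := smoothTrace_comp_eq_add_of_constituents_eq_pair (cmPrincipalSeriesH L v (torusCharPair (conjLocal L (IsCMField.complexConj L) v) (cmLocalForm L 2 v) (cmLocalForm_eq_over L 2 v) 0 χ₁ χ₂) χ) hadmH hlenH
      (IrrClass.boxChar χ hχ π₁) (IrrClass.boxChar χ hχ π₂) hne' hJHH (ContinuousMulEquiv.refl ((UnitaryGroup.cmDatum L 2 (Matrix.of fun i j : Fin 2 => if i.val + j.val + 1 = 2 then (1 : L) else 0)).Local v ×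
      (UnitaryGroup.cmDatum L 1 (Matrix.of fun i j : Fin 1 => if i.val + j.val + 1 = 1 then (1 : L) else 0)).Local v)) νH fH
    rw [IrrClass.comap_refl, IrrClass.comap_refl] at h
    exact h
  -- (W5-d) at `(θ, χ)`: a member of `ρ` is a constituent of `i_H`
  have hmem : IrrClass.boxChar χ hχ π₁ ∈ ρ := by
    rw [hρO, Finset.mem_map]
    exact ⟨π₁, by rw [hOeq]; exact Finset.mem_insert_self _ _, rfl⟩
  obtain ⟨ε, W, i₁, i₂, I, hIadm, hIfl, hid⟩ := h492 (torusCharPair (conjLocal L (IsCMField.complexConj L) v) (cmLocalForm L 2 v) (cmLocalForm_eq_over L 2 v) 0 χ₁ χ₂) χ hχ ⟨_, hmem, (hJHH _).2 (Or.inr rfl)⟩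
  refine ⟨ε, W, i₁, i₂, I, hIadm, hIfl, fun fH f hfH hf htr => ?_⟩
  rw [hsum, ← hTA, hid fH f hfH hf htr]

end Summit.HodgeConjecture.HodgeConjecture.R90.S3

end
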